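import Summits.QuantumFields.BalabanUV.Beta.D1BFx.TorusBorderedResolvent
import Summits.QuantumFields.BalabanUV.Beta.D1BFx.VectorPropagatorImages
import Summits.QuantumFields.BalabanUV.Beta.D1BFx.SortedEmbedding

/-!
# `BalabanUV.Beta.D1BFx.TorusMassiveResolvent` — road «BF-x» for binder row D1, slot (K), `K-ASSEMBLY-SPEC-v2.md` §1 brick 3c (part 2):
# **THE FIRST TORUS LETTER `hXG` OF `TorusBorderedResolvent` DISCHARGED** — `X̂(a∕(m+1)⁸) · Ĝ = 1` and `Ĝ · X̂(a∕(m+1)⁸) = 1` in the SORTED currency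
# over every coarse torus, i.e. the re-blocked torus gluon leg `Ĝ` IS the massive vector resolvent: the sorted-currency transport
# (leaf-03-g8's `SortedEmbedding.reblock_hat_mul_eq_one`, ρ-g6-2b) of this lineage's fine-torus Lemma 2.2.2 `VectorPropagatorImages.periodiseF_X1aKer_mul_GaF`,
# MODULO the displayed decay `Spr (Ga (m+1) a)` only

HONEST FRAMING (cell contract, verbatim): «discharging `BetaPertH` makes Bałaban's UV stability UNCONDITIONAL — a real constructive-QFT
result; it is NOT the continuum limit and NOT the Clay problem.»  HONEST DEPENDENCY (verbatim): «continuum YM on T⁴ ⇐ BetaPertH ∧ nine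
spine estimates (0/9 proved); BetaPertH ⇐ (D1) ∧ (D4) ∧ CAP+tail; G-an2-4 gates asym, D1 and NE2/3/4.»  THIS MODULE DISCHARGES NOTHING of
D1 / BetaPertH: [folklore] bookkeeping BY NAME over `VectorPropagatorImages` (`periodiseF_X1aKer_mul_GaF`, `Kfib_X1aKer`, `summable_Kfib_X1aKer`,
`compKer_dzKer_Pker_codiffKer`, `isPeriodic₂_GaF`), gan24-leaf-06-g28's `StencilKernels` ∕ `StencilDictionaryEntries` (periodicity of the stencil
kernels), this lineage's `PeriodisedKernels.isPeriodic₂_Pker`, leaf-03-g8's `SortedEmbedding.reblock_hat_mul_eq_one`, an4's `EntrywiseVolumeLimit`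
(`IsPeriodic₂`, `Decay₂`), and part 1 `TorusBorderedResolvent`.  No `def`, no `def … : Prop`, nothing cited, 0 sorry.  The decay of `Ga` is the
DISPLAYED hypothesis `hGa : Spr (Ga (m+1) a)` (printed [B5, Prop. 1.2] ∧ [B5, (1.126)–(1.127)], `GluonLegTails.spr_Ga_of_prop12`); the two
remaining torus letters `hlin`, `hgram` of part 1 (brick 3b-Q, leaf-03-g8 «K-TB2-Q») stay displayed.  NOT summit progress; NOT BetaPertH,
NOT continuum, NOT Clay.

ABSOLUTE RULE (cell, verbatim): «No internally-minted statement may enter as a cited fact. Every hypothesis is either kernel-proved in this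
package or a verbatim quotation of a PUBLISHED theorem with page reference. The manuscript(s) under audit are NOT citable for their own
disputed steps — they are the thing under adjudication; programme-internal (2001/route/tribunal) claims are never citable.»

CONTENT (`m`, `a > 0`, coarse period `p`; all [folklore]).
* §1 periodicity and summability of the fibres in the `MKer` reading: `isPeriodic₂_Kfib_X1aKer` (every `s` with `m+1 ∣ s`), `isPeriodic₂_X1aM`,
  `summable_X1aM_row`, `isPeriodic₂_Ga_fibre`, `summable_Ga_row` (⟸ `Spr`), `toF_Ga` (`toF (Ga n a) = GaF n a`, rfl).
* §2 **`Xhat_mul_Ghat`**: `Xhat m a p (a∕(m+1)⁸) * Ghat m a p = 1 ∧ Ghat m a p * Xhat m a p (a∕(m+1)⁸) = 1`; `isUnit_det_Ghat`.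
* §3 part 1 with `hXG` discharged: **`inv_NT_eq_fromBlocks_of_letters`**, `isUnit_det_NT_of_letters` — modulo `hlin`, `hgram` (brick 3b-Q) and `Spr (Ga (m+1) a)`.
Unit `b2b-balaban-beta-d1-p2` (road owner, gen 6).
-/

noncomputable section

namespace Summit.QuantumFields.BalabanUV.Beta.D1BFx.TorusMassiveResolvent

open Matrix
open scoped BigOperators
open Literature.MathematicalPhysics.QuantumFieldTheory.Balaban1983to89
open Literature.MathematicalPhysics.QuantumFieldTheory.Balaban1983to89.Beta
open ExpKernelCalculus (MKer Decays)
open B6QGQLower276 (X lapKer)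
open Summit.QuantumFields.BalabanUV.Beta.TameKernelCalculus (Spr)
open Summit.QuantumFields.BalabanUV.Beta.D1BFx.FibredPeriodisation (FKer Kfib Kfib_apply periodiseF isPeriodic₂_compKer)
open Summit.QuantumFields.BalabanUV.Beta.D1BFx.PeriodicArrays (toF)
open Summit.QuantumFields.BalabanUV.Beta.D1BFx.SortedReblocking (reblock)
open Summit.QuantumFields.BalabanUV.Beta.D1BFx.SortedEmbedding (reblock_hat_mul_eq_one)
open Summit.QuantumFields.BalabanUV.Beta.D1BFx.TorusCombKKT (I J Qhat)
open Summit.QuantumFields.BalabanUV.Beta.D1BFx.StencilKernels (dzKer codiffKer qqKer isPeriodic₂_lapKer isPeriodic₂_dzKer isPeriodic₂_codiffKer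
  isPeriodic₂_qqKer)
open Summit.QuantumFields.BalabanUV.Beta.D1BFx.StencilDictionaryEntries (lapF qqF Kfib_lapF Kfib_qqF)
open Summit.QuantumFields.BalabanUV.Beta.D1BFx.PeriodisedKernels (isPeriodic₂_Pker)
open Summit.QuantumFields.BalabanUV.Beta.D1BFx.RProjector (Pker)
open Summit.QuantumFields.BalabanUV.Beta.D1BFx.VectorLegKernelForm (X1aKer GaF)
open Summit.QuantumFields.BalabanUV.Beta.D1BFx.VectorPropagatorImages (gaugeF Kfib_X1aKer summable_Kfib_X1aKer compKer_dzKer_Pker_codiffKer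
  isPeriodic₂_GaF periodiseF_X1aKer_mul_GaF)
open Summit.QuantumFields.BalabanUV.Beta.D1BFx.GluonLeg (Ga)
open Summit.QuantumFields.BalabanUV.Beta.D1BFx.CoarseGramInverse (gramM)
open Summit.QuantumFields.BalabanUV.Beta.D1BFx.TorusBorderedResolvent (X1aM toF_X1aM Xhat Ghat Chat NT isUnit_det_NT inv_NT_eq_fromBlocks)

variable (m : ℕ) {a : ℝ}

/-! ## §1 Periodicity and summability of the fibres -/

/-- [folklore] The fibres of the four-point gauge kernel are jointly `s`-periodic for `m+1 ∣ s` (product of periodic stencils and the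
block-covariant `P`, `compKer_dzKer_Pker_codiffKer`). -/
theorem isPeriodic₂_Kfib_gaugeF (ha : 0 < a) {s : ℕ} (hdiv : m + 1 ∣ s) (κ l : Fin 4) : IsPeriodic₂ s (Kfib (gaugeF m a) κ l) := by
  rw [← compKer_dzKer_Pker_codiffKer]
  exact isPeriodic₂_compKer (isPeriodic₂_dzKer κ s) (isPeriodic₂_compKer (isPeriodic₂_Pker m ha hdiv) (isPeriodic₂_codiffKer l s))

/-- [folklore] **THE FIBRES OF X₁a's KERNEL ARE JOINTLY `s`-PERIODIC** for every `s` with `m+1 ∣ s` (Laplacian and averaging stencils + the gauge term). -/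
theorem isPeriodic₂_Kfib_X1aKer (ha : 0 < a) {s : ℕ} (hdiv : m + 1 ∣ s) (a' : ℝ) (κ l : Fin 4) :
    IsPeriodic₂ s (Kfib (X1aKer (m + 1) a a') κ l) := by
  have hL : IsPeriodic₂ s (Kfib (lapF (d := 4)) κ l) := by
    rw [Kfib_lapF]; split_ifs
    · exact isPeriodic₂_lapKer s
    · intro x y t; rfl
  have hQ : IsPeriodic₂ s (Kfib (qqF (d := 4) (m + 1)) κ l) := by
    rw [Kfib_qqF]; split_ifs
    · exact (isPeriodic₂_qqKer (m + 1) (Nat.le_add_left 1 m) κ).of_dvd hdiv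
    · intro x y t; rfl
  have hG := isPeriodic₂_Kfib_gaugeF m ha hdiv κ l
  intro x y t
  rw [Kfib_X1aKer, Kfib_X1aKer, hL x y t, hQ x y t, hG x y t]

/-- [folklore] The same in the `MKer` reading `X1aM`. -/
theorem isPeriodic₂_X1aM (ha : 0 < a) {s : ℕ} (hdiv : m + 1 ∣ s) (a' : ℝ) (κ l : Fin 4) :
    IsPeriodic₂ s (fun x x' => X1aM (m + 1) a a' x x' κ l) :=
  isPeriodic₂_Kfib_X1aKer m ha hdiv a' κ l

/-- [folklore] Rows of `X1aM` are summable (`summable_Kfib_X1aKer`). -/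
theorem summable_X1aM_row (ha : 0 < a) (a' : ℝ) (κ l : Fin 4) (x : X 4) :
    Summable fun x' => X1aM (m + 1) a a' x x' κ l :=
  summable_Kfib_X1aKer m ha a' κ l x

/-- [folklore] `toF (Ga n a) = GaF n a` (both read `Ga` fibre-second). -/
theorem toF_Ga (n : ℕ) [NeZero n] (a : ℝ) : toF (Ga n a) = GaF n a := rfl

/-- [folklore] The fibres of the gluon leg are jointly `s`-periodic for `m+1 ∣ s`. -/
theorem isPeriodic₂_Ga_fibre (a : ℝ) {s : ℕ} (hdiv : m + 1 ∣ s) (κ l : Fin 4) :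
    IsPeriodic₂ s (fun x x' => Ga (m + 1) a x x' κ l) :=
  isPeriodic₂_GaF m hdiv κ l

/-- [folklore] Rows of the gluon leg are summable, from its (displayed) decay. -/
theorem summable_Ga_row (hGa : Spr (Ga (m + 1) a)) (κ l : Fin 4) (x : X 4) : Summable fun x' => Ga (m + 1) a x x' κ l := by
  obtain ⟨C, δ, hδ, hdec⟩ := hGa
  have h2 : Decay₂ (fun x x' => Ga (m + 1) a x x' κ l) C δ := fun x x' => hdec x x' κ l
  exact h2.summable_row hδ x

/-! ## §2 The first torus letter: `X̂(a∕(m+1)⁸)·Ĝ = 1` -/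

variable (p : ℕ) [NeZero p]

/-- [folklore] **THE RE-BLOCKED GLUON LEG IS THE TORUS MASSIVE RESOLVENT** (sorted currency over the coarse torus `Site 4 p`):
`Xhat m a p (a∕(m+1)⁸) * Ghat m a p = 1 ∧ Ghat m a p * Xhat m a p (a∕(m+1)⁸) = 1` — the letter `hXG` of `TorusBorderedResolvent`, modulo `Spr (Ga (m+1) a)`. -/
theorem Xhat_mul_Ghat (ha : 0 < a) (hGa : Spr (Ga (m + 1) a)) :
    Xhat m a p (a / ((m + 1 : ℕ) : ℝ) ^ 8) * Ghat m a p = 1 ∧ Ghat m a p * Xhat m a p (a / ((m + 1 : ℕ) : ℝ) ^ 8) = 1 := by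
  have hdiv : m + 1 ∣ (m + 1) * p := ⟨p, rfl⟩
  have hfine := periodiseF_X1aKer_mul_GaF m (p := p) ha hGa
  refine ⟨?_, ?_⟩
  · exact reblock_hat_mul_eq_one (isPeriodic₂_X1aM m ha hdiv _) (summable_X1aM_row m ha _)
      (isPeriodic₂_Ga_fibre m a hdiv) (summable_Ga_row m hGa) hfine.1
  · exact reblock_hat_mul_eq_one (isPeriodic₂_Ga_fibre m a hdiv) (summable_Ga_row m hGa)
      (isPeriodic₂_X1aM m ha hdiv _) (summable_X1aM_row m ha _) hfine.2

/-- [folklore] Hence the torus gluon leg is invertible. -/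
theorem isUnit_det_Ghat (ha : 0 < a) (hGa : Spr (Ga (m + 1) a)) : IsUnit (Ghat m a p).det :=
  Matrix.isUnit_det_of_left_inverse (Xhat_mul_Ghat m p ha hGa).1

/-! ## §3 Part 1 with the first letter discharged -/

/-- [folklore] **`N_T` IS INVERTIBLE**, modulo the 3b-Q letters `hlin`, `hgram` and `Spr (Ga (m+1) a)` (the letter `hXG` is `Xhat_mul_Ghat`). -/
theorem isUnit_det_NT_of_letters (ha : 0 < a) (hGa : Spr (Ga (m + 1) a))
    (hlin : Xhat m a p (a / ((m + 1 : ℕ) : ℝ) ^ 8)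
      = Xhat m a p 0 + (a / ((m + 1 : ℕ) : ℝ) ^ 8) • ((Qhat (d := 3) (m + 1) p)ᵀ * Qhat (d := 3) (m + 1) p))
    (hgram : Qhat (d := 3) (m + 1) p * Ghat m a p * (Qhat (d := 3) (m + 1) p)ᵀ
      = Matrix.of (periodiseF p (toF (gramM (m + 1) (Ga (m + 1) a))))) :
    IsUnit (NT m a p).det :=
  isUnit_det_NT ha hGa (Xhat_mul_Ghat m p ha hGa).1 hlin hgram

/-- [folklore] **THE BLOCKS OF `N_T⁻¹`**, modulo the 3b-Q letters `hlin`, `hgram` and `Spr (Ga (m+1) a)` only: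
`N_T⁻¹ = fromBlocks (½(Ĝ − ĜQ̂ᵀĈQ̂Ĝ)) (ĜQ̂ᵀĈ) (ĈQ̂Ĝ) ((2a∕(m+1)⁸)•1 − 2Ĉ)`. -/
theorem inv_NT_eq_fromBlocks_of_letters (ha : 0 < a) (hGa : Spr (Ga (m + 1) a))
    (hlin : Xhat m a p (a / ((m + 1 : ℕ) : ℝ) ^ 8)
      = Xhat m a p 0 + (a / ((m + 1 : ℕ) : ℝ) ^ 8) • ((Qhat (d := 3) (m + 1) p)ᵀ * Qhat (d := 3) (m + 1) p))
    (hgram : Qhat (d := 3) (m + 1) p * Ghat m a p * (Qhat (d := 3) (m + 1) p)ᵀ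
      = Matrix.of (periodiseF p (toF (gramM (m + 1) (Ga (m + 1) a))))) :
    (NT m a p)⁻¹
      = Matrix.fromBlocks
          ((1 / 2 : ℝ) • (Ghat m a p - Ghat m a p * (Qhat (d := 3) (m + 1) p)ᵀ * Chat m a p * Qhat (d := 3) (m + 1) p * Ghat m a p))
          (Ghat m a p * (Qhat (d := 3) (m + 1) p)ᵀ * Chat m a p)
          (Chat m a p * Qhat (d := 3) (m + 1) p * Ghat m a p)
          ((2 * a / ((m + 1 : ℕ) : ℝ) ^ 8) • (1 : Matrix (J 3 p) (J 3 p) ℝ) - (2 : ℝ) • Chat m a p) :=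
  inv_NT_eq_fromBlocks ha hGa (Xhat_mul_Ghat m p ha hGa).1 hlin hgram

end Summit.QuantumFields.BalabanUV.Beta.D1BFx.TorusMassiveResolvent

end
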